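import Summits.Ventures.PercRepro.Night2OneFatCaseOneGeom
import Summits.Ventures.PercRepro.Night2OneFatCaseOneGeomB

/-!
# PercRepro — the faces of the sources of a one-coloop target: closures and coloops (night-2, gen 29)

Two identifications for the case-1 assembly (proofs/NIGHT-2-g29.md §4‴ (i)):
* `clF_erase_eq_of_mem_clF` / **`clF_face_coloop_eq`**: for a point `y ∈ S ∖ K` that is not a coloop of `S ∖ K`, the face of
  `S ∖ y` at the coloop `w` has the same closure as `S ∖ w` — the three sources share the hyperplane `H = cl (S ∖ w)`;
* **`coloops_erase_of_triple`**: if `y₂, y₃` are coloops of `(S ∖ K) ∖ y₁` (none of `y₁, y₂, y₃` a coloop of `S ∖ K`, which has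
  rank `5`), then `y₁, y₃` are coloops of `(S ∖ K) ∖ y₂` — the triple is symmetric, so the face closures of the three
  sources are the four sets `cl (S ∖ w)`, `cl (P ∪ y_a)`.
-/

namespace PercRepro.Shadow

open Finset PerFlat ThmH

variable {α : Type*} [DecidableEq α] {M : Matroid α} [M.Finite] {G : Finset α}

section CaseOneGeomC

/-- Inserting a point of the closure does not change the closure. -/
theorem clF_insert_eq_of_mem_clF {X : Finset α} (hX : X ⊆ gr M) {y : α} (hy : y ∈ clF M X) :
    clF M (insert y X) = clF M X := by
  apply le_antisymm
  · exact clF_subset_clF_of_subset_clF (Finset.insert_subset hy (subset_clF_of_subset_gr hX))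
  · exact clF_mono (Finset.subset_insert _ _)

/-- **The face at the coloop has the same closure as `S ∖ w`**: `cl ((S ∖ y) ∖ w) = cl (S ∖ w)` for `y ∈ S ∖ K` not a
coloop of `S ∖ K` (`S ⊆ G`, `rk (S ∖ K) = 5`, `w` a coloop of `S ∖ K`). -/
theorem clF_face_coloop_eq (hG : G ∈ flatsQ M (5 + 1)) {S : Finset α} (hSG : S ⊆ G)
    (hS5 : rkN M (S \ coloops M G) = 5) {w : α} (hw : w ∈ coloops M (S \ coloops M G)) {y : α}
    (hy : y ∈ S \ coloops M G) (hyw : y ≠ w) (hyc : y ∉ coloops M (S \ coloops M G)) :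
    clF M ((S.erase y).erase w) = clF M (S.erase w) := by
  have hGg : G ⊆ gr M := (mem_flatsQ.1 hG).1
  have hVg : S \ coloops M G ⊆ gr M := Finset.sdiff_subset.trans (hSG.trans hGg)
  have hy5 : rkN M ((S \ coloops M G).erase y) = 5 := by
    rw [rkN_erase_of_not_coloop hVg (Finset.mem_sdiff.1 hy |>.elim (fun a b => Finset.mem_sdiff.2 ⟨a, b⟩)) hyc]
    exact hS5
  have hycl : y ∈ clF M (((S \ coloops M G).erase y).erase w) := mem_clF_face_coloop hVg hS5 hw hy hyw hy5
  have hycl' : y ∈ clF M ((S.erase y).erase w) := by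
    refine clF_mono ?_ hycl
    intro a ha
    rw [Finset.mem_erase, Finset.mem_erase, Finset.mem_sdiff] at ha
    exact Finset.mem_erase.2 ⟨ha.1, Finset.mem_erase.2 ⟨ha.2.1, ha.2.2.1⟩⟩
  have heq : S.erase w = insert y ((S.erase y).erase w) := by
    rw [Finset.erase_right_comm, Finset.insert_erase (Finset.mem_erase.2 ⟨hyw, (Finset.mem_sdiff.1 hy).1⟩)]
  rw [heq, clF_insert_eq_of_mem_clF (((Finset.erase_subset _ _).trans (Finset.erase_subset _ _)).trans
    (hSG.trans hGg)) hycl']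

/-- **The triple of coloops is symmetric**: with `V` of rank `5`, `y₁, y₂, y₃ ∈ V` distinct and none a coloop of `V`, if
`y₂, y₃` are coloops of `V ∖ y₁` then `y₁` and `y₃` are coloops of `V ∖ y₂`. -/
theorem coloops_erase_of_triple {V : Finset α} (hVg : V ⊆ gr M) (hV5 : rkN M V = 5) {y₁ y₂ y₃ : α}
    (hy₁ : y₁ ∈ V) (hy₂ : y₂ ∈ V) (hy₃ : y₃ ∈ V) (h12 : y₁ ≠ y₂) (h13 : y₁ ≠ y₃) (h23 : y₂ ≠ y₃)
    (hc₂ : y₂ ∉ coloops M V) (hc₃ : y₃ ∉ coloops M V)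
    (hcol₂ : y₂ ∈ coloops M (V.erase y₁)) (hcol₃ : y₃ ∈ coloops M (V.erase y₁)) :
    y₁ ∈ coloops M (V.erase y₂) ∧ y₃ ∈ coloops M (V.erase y₂) := by
  set P := ((V.erase y₁).erase y₂).erase y₃ with hP
  have hPg : P ⊆ gr M := ((Finset.erase_subset _ _).trans ((Finset.erase_subset _ _).trans
    (Finset.erase_subset _ _))).trans hVg
  -- ranks: `rk (V ∖ y₁) = 5` (as in `mem_clF_base_of_mem_two_faces`), `rk P = 3`
  have hQ5 : rkN M (V.erase y₁) = 5 := by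
    have h1 := rkN_erase_of_not_coloop hVg hy₃ hc₃
    rw [hV5] at h1
    have h2 : rkN M (V.erase y₁) = rkN M ((V.erase y₁).erase y₃) + 1 :=
      rkN_erase_of_mem_coloops (M := M) ((Finset.erase_subset _ _).trans hVg) hcol₃
    have h3 : rkN M (V.erase y₃) ≤ rkN M ((V.erase y₁).erase y₃) + 1 := by
      have heq : V.erase y₃ = insert y₁ ((V.erase y₁).erase y₃) := by
        rw [Finset.erase_right_comm, Finset.insert_erase (Finset.mem_erase.2 ⟨h13, hy₁⟩)]
      rw [heq]
      by_cases hcl : y₁ ∈ clF M ((V.erase y₁).erase y₃)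
      · have := rkN_insert_le_of_mem_clF (M := M) ((Finset.erase_subset _ _).trans
          ((Finset.erase_subset _ _).trans hVg)) hcl
        omega
      · have := rkN_insert_of_notMem_clF (M := M) (hVg hy₁) hcl
        omega
    have h4 : rkN M (V.erase y₁) ≤ 5 := by rw [← hV5]; exact rkN_mono (Finset.erase_subset _ _)
    omega
  have hcol₃' : y₃ ∈ coloops M ((V.erase y₁).erase y₂) := mem_coloops_erase_of_mem_coloops hcol₃ h23.symm
  have hP3 : rkN M P = 3 := by
    have h1 : rkN M (V.erase y₁) = rkN M ((V.erase y₁).erase y₂) + 1 :=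
      rkN_erase_of_mem_coloops (M := M) ((Finset.erase_subset _ _).trans hVg) hcol₂
    have h2 : rkN M ((V.erase y₁).erase y₂) = rkN M P + 1 :=
      rkN_erase_of_mem_coloops (M := M) ((Finset.erase_subset _ _).trans
        ((Finset.erase_subset _ _).trans hVg)) hcol₃'
    rw [hQ5] at h1
    omega
  -- `V ∖ y₂ = insert y₁ (insert y₃ P)` has rank `5`; `rk (insert y₁ P) = 4 = rk (insert y₃ P)`
  have hV2 : V.erase y₂ = insert y₁ (insert y₃ P) := by
    rw [hP]
    ext a
    simp only [Finset.mem_insert, Finset.mem_erase]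
    constructor
    · rintro ⟨ha2, haV⟩
      by_cases h1 : a = y₁
      · exact Or.inl h1
      · by_cases h3 : a = y₃
        · exact Or.inr (Or.inl h3)
        · exact Or.inr (Or.inr ⟨h3, ha2, h1, haV⟩)
    · rintro (rfl | rfl | ⟨ha3, ha2, ha1, haV⟩)
      · exact ⟨h12, hy₁⟩
      · exact ⟨h23.symm, hy₃⟩
      · exact ⟨ha2, haV⟩
  have hV2r : rkN M (V.erase y₂) = 5 := by rw [rkN_erase_of_not_coloop hVg hy₂ hc₂, hV5]
  have hr4 : ∀ y, y ∈ V → rkN M (insert y P) ≤ 4 := by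
    intro y hyV
    by_cases hcl : y ∈ clF M P
    · have := rkN_insert_le_of_mem_clF (M := M) hPg hcl; omega
    · have := rkN_insert_of_notMem_clF (M := M) (hVg hyV) hcl; omega
  -- `y₁` is a coloop of `V ∖ y₂`: `y₁ ∉ cl (insert y₃ P)` (rank `≤ 4 < 5`)
  have hy₁P : y₁ ∈ V.erase y₂ := Finset.mem_erase.2 ⟨h12, hy₁⟩
  have hy₃P : y₃ ∈ V.erase y₂ := Finset.mem_erase.2 ⟨h23.symm, hy₃⟩
  have hy₁e : (V.erase y₂).erase y₁ = insert y₃ P := by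
    rw [hV2, Finset.erase_insert]
    rw [Finset.mem_insert, not_or]
    refine ⟨h13, ?_⟩
    rw [hP]
    simp only [Finset.mem_erase, not_and]
    intro h1 h2 h3
    exact absurd rfl h3
  have hy₃e : (V.erase y₂).erase y₃ = insert y₁ P := by
    rw [hV2, Finset.insert_comm, Finset.erase_insert]
    rw [Finset.mem_insert, not_or]
    refine ⟨h13.symm, ?_⟩
    rw [hP]
    simp only [Finset.mem_erase, not_and]
    intro h1
    exact absurd rfl h1
  constructor
  · rw [mem_coloops, hy₁e]
    refine ⟨hy₁P, fun hcl => ?_⟩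
    have h1 := rkN_insert_le_of_mem_clF (M := M) (Finset.insert_subset (hVg hy₃) hPg) hcl
    have h2 := hr4 y₃ hy₃
    rw [← hV2] at h1
    omega
  · rw [mem_coloops, hy₃e]
    refine ⟨hy₃P, fun hcl => ?_⟩
    have h1 := rkN_insert_le_of_mem_clF (M := M) (Finset.insert_subset (hVg hy₁) hPg) hcl
    have h2 := hr4 y₁ hy₁
    rw [Finset.insert_comm, ← hV2] at h1
    omega

end CaseOneGeomC

end PercRepro.Shadow
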